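import Mathlib
import Summits.Ventures.HodgeRepro2.Tier7.Line3.LevelInvariantOrbital

/-!
# Tier7/Line3/LevelFactorData — the three `b`-fields of `KappaData` from local factor data (`b_support`, `b_bound`, `b_γ₀`)
(seat t7-x1, gen 3; the finite-factor analogue of L1-p5's `KappaDataFinLocal` / x1's `FinKappaOfLocalData` for the κ-fields)

LINE 3 (t7-plan-3), version (ii). x1's `KappaData` (DominantSideOfKappa p677612) carries the finite factors of the
geometric side as three fields — `b_support : b N γ ≠ 0 → arith N γ`, `b_bound : ∃ Bb, ∀ N γ, arith N γ → ‖b N γ‖ ≤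
Bb · (1 + size γ)^ε · ‖b N γ₀‖`, `b_γ₀ : ∃ N₀, ∀ N ≥ N₀, b N γ₀ ≠ 0` — as HYPOTHESES. This module DERIVES all three from
`LevelFactorData`: the factor factorises as `b N γ = bS γ · bv N γ` with
* `bv N γ` the LEVEL factor at `v₁`, DEFINED as LevelInvariantOrbital's twisted orbital integral of the coset indicator
  `1_{γ₀ K_N}` at a local representative `loc γ` of the double coset (the level tower `K_N` normalised by `ι_B(B)`) — its
  three properties are THEOREMS (p690899 / v2 p692410): it vanishes off the local support (`b_support`'s half), its norm
  is constant on the local support at every level (`b_bound`'s half, the `v₁`-uniformity), and it is non-zero at `γ₀`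
  for `N ≥ N₀` (`bv_γ₀` — displayed here; LevelFactorPositive p691647 derives it from local constancy + the central
  match + shrinking open levels);
* `bS γ` the `N`-INDEPENDENT part (the places `≠ v₁`), with its own three clauses displayed: support (`bS γ ≠ 0 →
  arithS γ`), growth on the support (`‖bS γ‖ ≤ C (1 + size γ)^ε ‖bS γ₀‖` — the split places' box counts / DivisorBound
  p672115, the places of `S` by CompactTorusFactorBound p678241, the inert unramified places by
  `orbital_indicator_one_of_le_of_trivial`), and `bS γ₀ ≠ 0` (LocalFactorPositive p664522).
With `arith N γ := arithS γ ∧ InSupport ι_A ι_B (loc γ₀) (K N) (loc γ)` the three `KappaData` fields follow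
(`b_support`, `b_bound`, `b_γ₀`), so the finite side of the dominance is, like the κ-side, «local torus-translate data at
the model». DICTIONARY (in words, [M]-level, not distance to (P); TYPING-CENSUS T7): `loc γ` = the `v₁`-component of any
representative of the real double coset (only the norm of `bv` is used — representative-independent, p690899 record (e));
`arithS` = the support condition at the places `≠ v₁`; `bS` = the product of the other local factors. Nothing here is
about (N), (P), the real `X`, or HC_CM; §8(d): NO. Blind lane: Mathlib + the HodgeRepro2 prefix; no sorry;
axioms ⊆ {propext, Classical.choice, Quot.sound}.
-/

namespace Summit.Ventures.HodgeRepro2.Tier7.Line3.LevelFactor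

open MeasureTheory LevelInvariantOrbital

/-- **the finite-factor data at the model**: the `N`-independent part `bS` with its three displayed clauses, and the
level tower at `v₁` with a local representative `loc` of each double coset. -/
structure LevelFactorData (A B G Orb : Type*) [Group A] [Group B] [Group G] [MeasurableSpace A]
    [MeasurableSpace B] (μA : Measure A) (μB : Measure B) where
  /-- the torus `T_A(F_{v₁})` in the local group -/
  ιA : A →* G
  /-- the torus `T_B(F_{v₁})` in the local group -/
  ιB : B →* G
  /-- the character `μ_{A,v₁}` -/
  χA : A →* ℂ
  /-- the character `μ_{B,v₁}⁻¹` -/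
  ψB : B →* ℂ
  hχA : ∀ a, ‖χA a‖ = 1
  hψB : ∀ b, ‖ψB b‖ = 1
  /-- the level tower `K_N` at `v₁` -/
  K : ℕ → Subgroup G
  /-- each level normalised by `ι_B(B)` (`T_B(F_{v₁}) ⊂ K₁ ⊳ K_N`) -/
  hK : ∀ N, Normalizes ιB (K N)
  /-- a local representative at `v₁` of each double coset -/
  loc : Orb → G
  /-- the dominant coset -/
  γ₀ : Orb
  /-- the support condition at the places `≠ v₁` -/
  arithS : Orb → Prop
  /-- the `N`-independent factor (the places `≠ v₁`) -/
  bS : Orb → ℂ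
  bS_support : ∀ γ, bS γ ≠ 0 → arithS γ
  /-- the growth constant, the size and the exponent of the `N`-independent factor -/
  C : ℝ
  size : Orb → ℝ
  ε : ℝ
  bS_bound : ∀ γ, arithS γ → ‖bS γ‖ ≤ C * (1 + size γ) ^ ε * ‖bS γ₀‖
  bS_γ₀ : bS γ₀ ≠ 0
  /-- the level factor at `γ₀` is non-zero for `N ≥ N₀` (LevelFactorPositive p691647 supplies it) -/
  bv_γ₀ : ∃ N₀ : ℕ, ∀ N ≥ N₀,
    orbital μA μB ιA ιB χA ψB ((coset (loc γ₀) (K N)).indicator fun _ => (1 : ℂ)) (loc γ₀) ≠ 0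

namespace LevelFactorData

variable {A B G Orb : Type*} [Group A] [Group B] [Group G] [MeasurableSpace A] [MeasurableMul A]
  [MeasurableSpace B] [MeasurableMul B] {μA : Measure A} [μA.IsMulLeftInvariant] {μB : Measure B}
  [μB.IsMulLeftInvariant] (D : LevelFactorData A B G Orb μA μB)

/-- the level-`N` support: the support at the places `≠ v₁` and the local support `ι_A(A) γ₀ K_N ι_B(B)` at `v₁`. -/
def arith (N : ℕ) (γ : Orb) : Prop := D.arithS γ ∧ InSupport D.ιA D.ιB (D.loc D.γ₀) (D.K N) (D.loc γ)

/-- the LEVEL factor at `v₁`: the twisted orbital integral of `1_{γ₀ K_N}` at the local representative. -/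
noncomputable def bv (N : ℕ) (γ : Orb) : ℂ :=
  orbital μA μB D.ιA D.ιB D.χA D.ψB ((coset (D.loc D.γ₀) (D.K N)).indicator fun _ => (1 : ℂ)) (D.loc γ)

/-- the finite factor `b N γ = bS γ · bv N γ`. -/
noncomputable def b (N : ℕ) (γ : Orb) : ℂ := D.bS γ * D.bv N γ

omit [MeasurableMul A] [MeasurableMul B] [μA.IsMulLeftInvariant] [μB.IsMulLeftInvariant] in
/-- **`b_support`**: a non-zero finite factor forces the level-`N` support. -/
theorem b_support : ∀ N γ, D.b N γ ≠ 0 → D.arith N γ := by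
  intro N γ h
  have hS : D.bS γ ≠ 0 := left_ne_zero_of_mul h
  have hv : D.bv N γ ≠ 0 := right_ne_zero_of_mul h
  exact ⟨D.bS_support γ hS,
    inSupport_of_orbital_indicator_ne_zero μA μB D.ιA D.ιB D.χA D.ψB (D.loc D.γ₀) (D.K N) (D.loc γ) hv⟩

/-- **the level factor has constant norm on the level-`N` support** (p690899's level tower). -/
theorem norm_bv_eq : ∀ N γ, D.arith N γ → ‖D.bv N γ‖ = ‖D.bv N D.γ₀‖ := by
  intro N γ hγ
  exact norm_orbital_levelTower_indicator μA μB D.ιA D.ιB D.χA D.ψB D.hχA D.hψB D.K D.hK (D.loc D.γ₀)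
    N (D.loc γ) hγ.2

/-- **`b_bound`**: one constant for every level. -/
theorem b_bound : ∃ Bb : ℝ, ∀ N γ, D.arith N γ →
    ‖D.b N γ‖ ≤ Bb * (1 + D.size γ) ^ D.ε * ‖D.b N D.γ₀‖ :=
  ⟨D.C, b_bound_of_levelInvariant D.arith D.γ₀ D.bS D.bv D.C D.size D.ε
    (fun _ γ hγ => D.bS_bound γ hγ.1) D.norm_bv_eq⟩

omit [MeasurableMul A] [MeasurableMul B] [μA.IsMulLeftInvariant] [μB.IsMulLeftInvariant] in
/-- **`b_γ₀`**: the dominant finite factor is non-zero for `N` large. -/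
theorem b_γ₀ : ∃ N₀ : ℕ, ∀ N ≥ N₀, D.b N D.γ₀ ≠ 0 := by
  obtain ⟨N₀, h⟩ := D.bv_γ₀
  exact ⟨N₀, fun N hN => mul_ne_zero D.bS_γ₀ (h N hN)⟩

/-- **the three `b`-fields of `KappaData` at once** (`b_support ∧ b_bound ∧ b_γ₀`), for `arith := D.arith`,
`b := D.b`, `size := D.size`, `ε := D.ε`. -/
theorem kappaData_b_fields :
    (∀ N γ, D.b N γ ≠ 0 → D.arith N γ) ∧
    (∃ Bb : ℝ, ∀ N γ, D.arith N γ → ‖D.b N γ‖ ≤ Bb * (1 + D.size γ) ^ D.ε * ‖D.b N D.γ₀‖) ∧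
    (∃ N₀ : ℕ, ∀ N ≥ N₀, D.b N D.γ₀ ≠ 0) :=
  ⟨D.b_support, D.b_bound, D.b_γ₀⟩

end LevelFactorData

end Summit.Ventures.HodgeRepro2.Tier7.Line3.LevelFactor
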